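import Summits.Ventures.PercRepro.S3LPCellKit

/-!
# PercRepro — THE UPWARD ROWS BY CORE SIZE (p7 g23; an S4 feeder on p2 g30's `S2LP` machinery)

p2's LP has the exact upward identity `(n − k)·m[k, b] = Σ_s (k + 1 − s)·c_ν[k + 1, s] + Σ_s s·c_{ν+1}[k + 1, s]` and the
closure bound `Σ_s s·c_{ν+1}[k + 1, s] ≤ (F − k)·m[k, b]` — both AGGREGATED over the core size `s`. Refined by the core:
a `k`-set `S` of nullity `ν` with core size `s` and a point `x ∉ cl S` give `insert x S`, a `(k + 1)`-set of the SAME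
nullity and the SAME core (`x` is a new coloop); every `(k + 1)`-set of nullity `ν` with core size `s` arises this way
from each of its `k + 1 − s` coloops. Hence, with `F` a bound on the rank-`b` flats (`b = k − ν`),

  `(n − F)·#nuSets k ν s ≤ (k + 1 − s)·#nuSets (k + 1) ν s ≤ (n − k)·#nuSets k ν s`.

At level 7 these rows close the cells `(10, 9 … 13)` that the flat-maximality splits left open. Nothing is claimed
about any cell here.

The incidences «`S ∈ nuSets k ν s` inside a `(k + 1)`-set of rank `k − ν + 1`» are written out as the set
`{R ∈ S1.incPairs M k (k − ν) | R.1 ∈ nuSets M k ν s ∧ R.2 ∈ S1.rkSets M (k + 1) (k − ν + 1)}` (no definition).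

* `coloopsOf_insert_of_notMem_closure`, `core_insert_of_notMem_closure`, `mem_nuSets_succ_of_notMem_closure`,
  `sdiff_mem_nuSets_of_mem_coloopsOf`, `fibre_upsPairs_snd_eq`, `ncard_upsPairs_eq`, `fibre_upsPairs_fst_eq`,
  `ncard_upsPairs_le`, `le_ncard_upsPairs_of_flat`, **`upsHi`**, **`upsLo_flat`**, **`upsLo_col`**.
Axioms: standard.
-/

open scoped Matroid

namespace PercRepro

namespace S4Ups

open Set Finset S2LP

variable {α : Type} {M : Matroid α} [M.Finite]

omit [M.Finite] in
/-- Adding a point outside the closure of `S` makes it a coloop and keeps the old coloops. -/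
theorem coloopsOf_insert_of_notMem_closure {S : Set α} {x : α} (hxE : x ∈ M.E) (hxS : x ∉ S)
    (hx : x ∉ M.closure S) : coloopsOf M (insert x S) = insert x (coloopsOf M S) := by
  have hr : M.eRk (insert x S) = M.eRk S + 1 := M.eRk_insert_eq_add_one ⟨hxE, hx⟩
  ext y
  simp only [coloopsOf, mem_setOf_eq, mem_insert_iff]
  constructor
  · rintro ⟨hy | hy, h⟩
    · exact Or.inl hy
    · right
      refine ⟨hy, ?_⟩
      have hyx : x ≠ y := fun h' => hxS (h' ▸ hy)
      rw [Set.insert_sdiff_of_notMem _ (by simpa using hyx), hr] at h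
      have hx' : x ∉ M.closure (S \ {y}) := fun h' => hx (M.closure_subset_closure sdiff_subset h')
      rw [M.eRk_insert_eq_add_one ⟨hxE, hx'⟩] at h
      exact WithTop.add_right_cancel (WithTop.one_ne_top) h
  · rintro (rfl | ⟨hy, h⟩)
    · refine ⟨Or.inl rfl, ?_⟩
      rw [insert_sdiff_self_of_notMem hxS, hr]
    · refine ⟨Or.inr hy, ?_⟩
      have hyx : x ≠ y := fun h' => hxS (h' ▸ hy)
      have hx' : x ∉ M.closure (S \ {y}) := fun h' => hx (M.closure_subset_closure sdiff_subset h')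
      rw [Set.insert_sdiff_of_notMem _ (by simpa using hyx), hr, M.eRk_insert_eq_add_one ⟨hxE, hx'⟩, h]

omit [M.Finite] in
/-- Adding a point outside the closure of `S` leaves the core unchanged. -/
theorem core_insert_of_notMem_closure {S : Set α} {x : α} (hxE : x ∈ M.E) (hxS : x ∉ S)
    (hx : x ∉ M.closure S) : core M (insert x S) = core M S := by
  unfold core
  rw [coloopsOf_insert_of_notMem_closure hxE hxS hx, insert_sdiff_of_mem _ (mem_insert x _),
    sdiff_insert_of_notMem hxS]

/-- A point outside the closure of a member of `nuSets k ν s` gives a member of `nuSets (k + 1) ν s`. -/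
theorem mem_nuSets_succ_of_notMem_closure {k ν s : ℕ} (hν : ν ≤ k) {S : Set α} (hS : S ∈ nuSets M k ν s) {x : α}
    (hxE : x ∈ M.E) (hxS : x ∉ S) (hx : x ∉ M.closure S) : insert x S ∈ nuSets M (k + 1) ν s := by
  obtain ⟨⟨hSE, hSk, hSr⟩, hcore⟩ := hS
  refine ⟨⟨insert_subset hxE hSE, ?_, ?_⟩, ?_⟩
  · rw [ncard_insert_of_notMem hxS (M.ground_finite.subset hSE), hSk]
  · rw [M.eRk_insert_eq_add_one ⟨hxE, hx⟩, hSr, show k + 1 - ν = (k - ν) + 1 by omega]; push_cast; rfl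
  · rw [core_insert_of_notMem_closure hxE hxS hx, hcore]

/-- Removing a coloop from a member of `nuSets (k + 1) ν s` gives a member of `nuSets k ν s`, of rank one less. -/
theorem sdiff_mem_nuSets_of_mem_coloopsOf {k ν s : ℕ} (hν : ν ≤ k) {T : Set α} (hT : T ∈ nuSets M (k + 1) ν s) {x : α}
    (hx : x ∈ coloopsOf M T) : T \ {x} ∈ nuSets M k ν s := by
  obtain ⟨⟨hTE, hTk, hTr⟩, hcore⟩ := hT
  have hxT : x ∈ T := hx.1
  have hxE : x ∈ M.E := hTE hxT
  have hTfin : T.Finite := M.ground_finite.subset hTE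
  have hncl : x ∉ M.closure (T \ {x}) := notMem_closure_of_mem_coloopsOf hTE hx
  have hxS : x ∉ T \ {x} := fun h => h.2 rfl
  have hins : insert x (T \ {x}) = T := insert_sdiff_self_of_mem hxT
  have hSE : T \ {x} ⊆ M.E := sdiff_subset.trans hTE
  refine ⟨⟨hSE, ?_, ?_⟩, ?_⟩
  · rw [ncard_sdiff' (singleton_subset_iff.mpr hxT) hTfin, ncard_singleton, hTk]; omega
  · have h := M.eRk_insert_eq_add_one ⟨hxE, hncl⟩
    rw [hins, hTr] at h
    have hfin : M.eRk (T \ {x}) ≠ ⊤ := eRk_ne_top_of_finite' (hTfin.subset sdiff_subset)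
    obtain ⟨a, ha⟩ := ENat.ne_top_iff_exists.mp hfin
    rw [← ha] at h ⊢
    have h' : k + 1 - ν = a + 1 := by exact_mod_cast h
    have : a = k - ν := by omega
    rw [this]
  · have h := core_insert_of_notMem_closure hxE hxS hncl
    rw [hins] at h
    rw [← h, hcore]

/-- The incidences are finite. -/
theorem upsPairs_finite (k ν s : ℕ) : ({R ∈ S1.incPairs M k (k - ν) | R.1 ∈ nuSets M k ν s ∧ R.2 ∈ S1.rkSets M (k + 1) (k - ν + 1)}).Finite :=
  (S1.incPairs_finite (M := M) k (k - ν)).subset (fun _ h => h.1)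

/-- The second component of an upward incidence lies in `nuSets (k + 1) ν s`. -/
theorem snd_mem_nuSets_of_mem_upsPairs {k ν s : ℕ} (hν : ν ≤ k) {R : Set α × Set α} (hR : R ∈ {R ∈ S1.incPairs M k (k - ν) | R.1 ∈ nuSets M k ν s ∧ R.2 ∈ S1.rkSets M (k + 1) (k - ν + 1)}) :
    R.2 ∈ nuSets M (k + 1) ν s := by
  obtain ⟨⟨hS, hTE, hTk, hST⟩, hSs, hTE', hTk', hTr⟩ := hR
  obtain ⟨⟨hSE, hSk, hSr⟩, hcore⟩ := hSs
  obtain ⟨x, hx, hTeq⟩ := S1.eq_insert_of_subset_of_ncard (M.ground_finite.subset hTE) hSk hTk hST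
  have hxE : x ∈ M.E := hTE hx.1
  have hncl : x ∉ M.closure R.1 := by
    intro hmem
    have h1 : M.eRk R.2 = M.eRk R.1 := by
      rw [hTeq, ← M.eRk_closure_eq, M.closure_insert_eq_of_mem_closure hmem, M.eRk_closure_eq]
    rw [hTr, hSr] at h1
    have : k - ν + 1 = k - ν := by exact_mod_cast h1
    omega
  rw [hTeq]
  exact mem_nuSets_succ_of_notMem_closure hν ⟨⟨hSE, hSk, hSr⟩, hcore⟩ hxE hx.2 hncl

/-- **The fibre over a `(k + 1)`-set `T ∈ nuSets (k + 1) ν s`** is the image of the coloops of `T` under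
`x ↦ (T ∖ {x}, T)`. -/
theorem fibre_upsPairs_snd_eq {k ν s : ℕ} (hν : ν ≤ k) {T : Set α} (hT : T ∈ nuSets M (k + 1) ν s) :
    {R ∈ {R ∈ S1.incPairs M k (k - ν) | R.1 ∈ nuSets M k ν s ∧ R.2 ∈ S1.rkSets M (k + 1) (k - ν + 1)} | R.2 = T} = (fun x => (T \ {x}, T)) '' coloopsOf M T := by
  obtain ⟨⟨hTE, hTk, hTr⟩, hcore⟩ := hT
  have hTr' : M.eRk T = ((k - ν + 1 : ℕ) : ℕ∞) := by rw [hTr, show k + 1 - ν = k - ν + 1 by omega]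
  ext ⟨S, T'⟩
  simp only [mem_setOf_eq, mem_image, Prod.mk.injEq]
  constructor
  · rintro ⟨⟨hinc, -, -⟩, hT'⟩
    have hT'' : T' = T := hT'
    subst T'
    have hmem : (S, T) ∈ {R ∈ S1.incPairs M k (k - ν) | R.2 = T} := ⟨hinc, rfl⟩
    rw [S1.fibre_incPairs_eq k (k - ν) hTE hTk, fibre_eq_coloopsOf hTE hTr'] at hmem
    obtain ⟨x, hx, hxeq⟩ := hmem
    simp only [Prod.mk.injEq] at hxeq
    exact ⟨x, hx, hxeq.1, rfl⟩
  · rintro ⟨x, hx, rfl, rfl⟩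
    have hS : T \ {x} ∈ nuSets M k ν s := sdiff_mem_nuSets_of_mem_coloopsOf hν ⟨⟨hTE, hTk, hTr⟩, hcore⟩ hx
    refine ⟨⟨⟨hS.1, hTE, hTk, sdiff_subset⟩, hS, hTE, hTk, hTr'⟩, rfl⟩

/-- **The incidence count from the top**: `#upsPairs k ν s = (k + 1 − s)·#nuSets (k + 1) ν s`. -/
theorem ncard_upsPairs_eq (k ν s : ℕ) (hν : ν ≤ k) :
    ({R ∈ S1.incPairs M k (k - ν) | R.1 ∈ nuSets M k ν s ∧ R.2 ∈ S1.rkSets M (k + 1) (k - ν + 1)}).ncard = (k + 1 - s) * (nuSets M (k + 1) ν s).ncard := by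
  have hfin := nuSets_finite (M := M) (k + 1) ν s
  have hUfin := upsPairs_finite (M := M) k ν s
  have heq : {R ∈ S1.incPairs M k (k - ν) | R.1 ∈ nuSets M k ν s ∧ R.2 ∈ S1.rkSets M (k + 1) (k - ν + 1)} = ⋃ T ∈ nuSets M (k + 1) ν s, {R ∈ {R ∈ S1.incPairs M k (k - ν) | R.1 ∈ nuSets M k ν s ∧ R.2 ∈ S1.rkSets M (k + 1) (k - ν + 1)} | R.2 = T} := by
    ext R
    simp only [mem_iUnion, mem_setOf_eq, exists_prop]
    constructor
    · intro hR; exact ⟨R.2, snd_mem_nuSets_of_mem_upsPairs hν hR, hR, rfl⟩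
    · rintro ⟨T, -, hR, -⟩; exact hR
  have hdisj : (nuSets M (k + 1) ν s).PairwiseDisjoint (fun T => {R ∈ {R ∈ S1.incPairs M k (k - ν) | R.1 ∈ nuSets M k ν s ∧ R.2 ∈ S1.rkSets M (k + 1) (k - ν + 1)} | R.2 = T}) := by
    intro T _ T' _ hTT
    rw [Function.onFun, Set.disjoint_left]
    rintro R ⟨-, h1⟩ ⟨-, h2⟩
    exact hTT (h1.symm.trans h2)
  rw [heq, hfin.ncard_biUnion (fun T _ => hUfin.subset (fun _ hR => hR.1)) hdisj,
    finsum_mem_eq_finite_toFinset_sum _ hfin]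
  rw [Finset.sum_congr rfl (fun T hT => by
    rw [Finite.mem_toFinset] at hT
    have hTr' : M.eRk T = ((k - ν + 1 : ℕ) : ℕ∞) := by
      rw [hT.1.2.2, show k + 1 - ν = k - ν + 1 by omega]
    rw [fibre_upsPairs_snd_eq hν hT, ← fibre_eq_coloopsOf hT.1.1 hTr',
      InjOn.ncard_image (S1.injOn_sdiff_pair (M := M) T (k - ν)), fibre_eq_coloopsOf hT.1.1 hTr',
      (coloopsOf_ncard_of_mem_nuSets hT).1] :
    ∀ T ∈ hfin.toFinset, {R ∈ {R ∈ S1.incPairs M k (k - ν) | R.1 ∈ nuSets M k ν s ∧ R.2 ∈ S1.rkSets M (k + 1) (k - ν + 1)} | R.2 = T}.ncard = k + 1 - s)]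
  rw [Finset.sum_const, smul_eq_mul, ← ncard_eq_toFinset_card _ hfin, mul_comm]

/-- **The fibre over a `k`-set `S ∈ nuSets k ν s`** is the image of the points `x ∉ S` with `ρ(insert x S) = ρ(S) + 1`
under `x ↦ (S, insert x S)`. -/
theorem fibre_upsPairs_fst_eq {k ν s : ℕ} {S : Set α} (hS : S ∈ nuSets M k ν s) :
    {R ∈ {R ∈ S1.incPairs M k (k - ν) | R.1 ∈ nuSets M k ν s ∧ R.2 ∈ S1.rkSets M (k + 1) (k - ν + 1)} | R.1 = S} =
      (fun x => (S, insert x S)) '' {x ∈ M.E \ S | M.eRk (insert x S) = ((k - ν + 1 : ℕ) : ℕ∞)} := by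
  obtain ⟨⟨hSE, hSk, hSr⟩, hcore⟩ := hS
  have hSfin : S.Finite := M.ground_finite.subset hSE
  ext ⟨S', T⟩
  simp only [mem_setOf_eq, mem_image, Prod.mk.injEq]
  constructor
  · rintro ⟨⟨⟨-, hTE, hTk, hST⟩, -, -, -, hTr⟩, hS'⟩
    have hS'' : S' = S := hS'
    subst S'
    obtain ⟨x, hx, hTeq⟩ := S1.eq_insert_of_subset_of_ncard (M.ground_finite.subset hTE) hSk hTk hST
    refine ⟨x, ⟨⟨hTE hx.1, hx.2⟩, ?_⟩, rfl, hTeq.symm⟩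
    rw [← hTeq]; exact hTr
  · rintro ⟨x, ⟨⟨hxE, hxS⟩, hxr⟩, rfl, rfl⟩
    have hTE : insert x S ⊆ M.E := insert_subset hxE hSE
    have hTk : (insert x S).ncard = k + 1 := by rw [ncard_insert_of_notMem hxS hSfin, hSk]
    exact ⟨⟨⟨⟨hSE, hSk, hSr⟩, hTE, hTk, subset_insert x S⟩, ⟨⟨hSE, hSk, hSr⟩, hcore⟩, hTE, hTk, hxr⟩, rfl⟩

/-- The points outside `S` split by the rank of `insert x S`: `ρ(S)` or `ρ(S) + 1`. -/
theorem ncard_ext_add_ncard_ext_succ {S : Set α} {b : ℕ} (hb : M.eRk S = (b : ℕ∞)) :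
    {x ∈ M.E \ S | M.eRk (insert x S) = (b : ℕ∞)}.ncard +
      {x ∈ M.E \ S | M.eRk (insert x S) = ((b + 1 : ℕ) : ℕ∞)}.ncard = (M.E \ S).ncard := by
  have hfin : (M.E \ S).Finite := M.ground_finite.subset sdiff_subset
  rw [← ncard_union_eq ?_ (hfin.subset (fun _ h => h.1)) (hfin.subset (fun _ h => h.1))]
  · congr 1
    ext x
    simp only [mem_union, mem_setOf_eq]
    constructor
    · rintro (h | h)
      · exact h.1
      · exact h.1
    · intro hx
      have hle : M.eRk (insert x S) ≤ ((b + 1 : ℕ) : ℕ∞) := by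
        push_cast; rw [← hb]; exact M.eRk_insert_le_add_one x S
      have hge : (b : ℕ∞) ≤ M.eRk (insert x S) := by rw [← hb]; exact M.eRk_mono (subset_insert x S)
      have hfin' : M.eRk (insert x S) ≠ ⊤ := ne_top_of_le_ne_top (ENat.coe_ne_top _) hle
      obtain ⟨a, ha⟩ := ENat.ne_top_iff_exists.mp hfin'
      rw [← ha] at hle hge
      have hle' : a ≤ b + 1 := by exact_mod_cast hle
      have hge' : b ≤ a := by exact_mod_cast hge
      rcases Nat.lt_or_ge a (b + 1) with hlt | hge2
      · left; refine ⟨hx, ?_⟩; rw [← ha]; have : a = b := by omega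
        rw [this]
      · right; refine ⟨hx, ?_⟩; rw [← ha]; have : a = b + 1 := by omega
        rw [this]
  · rw [Set.disjoint_left]
    rintro x ⟨-, h1⟩ ⟨-, h2⟩
    rw [h1] at h2
    have : b = b + 1 := by exact_mod_cast h2
    omega

/-- **The incidence count from the bottom, upper bound**: `#upsPairs k ν s ≤ (n − k)·#nuSets k ν s`. -/
theorem ncard_upsPairs_le (k ν s : ℕ) :
    ({R ∈ S1.incPairs M k (k - ν) | R.1 ∈ nuSets M k ν s ∧ R.2 ∈ S1.rkSets M (k + 1) (k - ν + 1)}).ncard ≤ (M.E.ncard - k) * (nuSets M k ν s).ncard := by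
  refine S1.ncard_le_mul_of_fibres (nuSets_finite k ν s) (fun S => {R ∈ {R ∈ S1.incPairs M k (k - ν) | R.1 ∈ nuSets M k ν s ∧ R.2 ∈ S1.rkSets M (k + 1) (k - ν + 1)} | R.1 = S}) ?_
    (fun S _ => (upsPairs_finite k ν s).subset (fun _ h => h.1)) (M.E.ncard - k) ?_
  · intro R hR
    rw [mem_iUnion₂]
    exact ⟨R.1, hR.2.1, hR, rfl⟩
  · intro S hS
    rw [fibre_upsPairs_fst_eq hS]
    have hsub : {x ∈ M.E \ S | M.eRk (insert x S) = ((k - ν + 1 : ℕ) : ℕ∞)} ⊆ M.E \ S := fun _ h => h.1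
    have hfin : (M.E \ S).Finite := M.ground_finite.subset sdiff_subset
    calc ((fun x => (S, insert x S)) '' {x ∈ M.E \ S | M.eRk (insert x S) = ((k - ν + 1 : ℕ) : ℕ∞)}).ncard
        ≤ {x ∈ M.E \ S | M.eRk (insert x S) = ((k - ν + 1 : ℕ) : ℕ∞)}.ncard := ncard_image_le (hfin.subset hsub)
      _ ≤ (M.E \ S).ncard := ncard_le_ncard hsub hfin
      _ = M.E.ncard - k := by rw [ncard_sdiff' hS.1.1 M.ground_finite, hS.1.2.1]

/-- **The incidence count from the bottom, lower bound with a flat bound**: if every set of rank `≤ k − ν` has at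
most `F` points, `(n − F)·#nuSets k ν s ≤ #upsPairs k ν s`. -/
theorem le_ncard_upsPairs_of_flat {F : ℕ} (k ν s : ℕ)
    (hflat : ∀ X ⊆ M.E, M.eRk X ≤ ((k - ν : ℕ) : ℕ∞) → X.ncard ≤ F) :
    (M.E.ncard - F) * (nuSets M k ν s).ncard ≤ ({R ∈ S1.incPairs M k (k - ν) | R.1 ∈ nuSets M k ν s ∧ R.2 ∈ S1.rkSets M (k + 1) (k - ν + 1)}).ncard := by
  refine S1.mul_le_ncard_of_fibres (upsPairs_finite k ν s) (nuSets_finite k ν s)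
    (fun S => {R ∈ {R ∈ S1.incPairs M k (k - ν) | R.1 ∈ nuSets M k ν s ∧ R.2 ∈ S1.rkSets M (k + 1) (k - ν + 1)} | R.1 = S}) (fun S _ => fun _ h => h.1) ?_ (M.E.ncard - F) ?_
  · intro S _ S' _ hSS
    rw [Function.onFun, Set.disjoint_left]
    rintro R ⟨-, h1⟩ ⟨-, h2⟩
    exact hSS (h1.symm.trans h2)
  · intro S hS
    rw [fibre_upsPairs_fst_eq hS]
    have hinj : InjOn (fun x => (S, insert x S)) {x ∈ M.E \ S | M.eRk (insert x S) = ((k - ν + 1 : ℕ) : ℕ∞)} := by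
      intro x hx y _ hxy
      simp only [Prod.mk.injEq, true_and] at hxy
      exact (insert_inj hx.1.2).mp hxy
    rw [hinj.ncard_image]
    have h1 := ncard_ext_add_ncard_ext_succ (M := M) hS.1.2.2
    have h2 := S1.ncard_extensions_add_le_of_flat hflat hS.1.1 hS.1.2.2
    rw [ncard_sdiff' hS.1.1 M.ground_finite, hS.1.2.1] at h1
    rw [hS.1.2.1] at h2
    omega

/-- **THE UPWARD ROW BY CORE SIZE, UPPER**: `(k + 1 − s)·#nuSets (k + 1) ν s ≤ (n − k)·#nuSets k ν s`. -/
theorem upsHi {n : ℕ} (hn : M.E.ncard = n) (k ν s : ℕ) (hν : ν ≤ k) :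
    (k + 1 - s) * (nuSets M (k + 1) ν s).ncard ≤ (n - k) * (nuSets M k ν s).ncard := by
  rw [← ncard_upsPairs_eq k ν s hν, ← hn]
  exact ncard_upsPairs_le k ν s

/-- **THE UPWARD ROW BY CORE SIZE, LOWER, WITH A FLAT BOUND**: if every set of rank `≤ b` has at most `F` points
(`b = k − ν`), `(n − F)·#nuSets k ν s ≤ (k + 1 − s)·#nuSets (k + 1) ν s`. -/
theorem upsLo_flat {n b F : ℕ} (hn : M.E.ncard = n) (hflat : ∀ X ⊆ M.E, M.eRk X ≤ (b : ℕ∞) → X.ncard ≤ F)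
    (k ν s : ℕ) (hν : ν ≤ k) (hbk : b = k - ν) :
    (n - F) * (nuSets M k ν s).ncard ≤ (k + 1 - s) * (nuSets M (k + 1) ν s).ncard := by
  subst hbk
  rw [← ncard_upsPairs_eq k ν s hν, ← hn]
  exact le_ncard_upsPairs_of_flat k ν s hflat

/-- **THE UPWARD ROW BY CORE SIZE, LOWER, WITH THE COLOOP-FREE BOUND**: in a coloop-free matroid of rank `p`, a
rank-`b` set (`b = k − ν < p`) has at most `n − (p − b + 1)` points in its closure, so
`(p − b + 1)·#nuSets k ν s ≤ (k + 1 − s)·#nuSets (k + 1) ν s`. -/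
theorem upsLo_col {p : ℕ} (hM : M.eRank = (p : ℕ∞)) (hcol : M.coloops = ∅) (k ν s : ℕ) (hν : ν ≤ k)
    (hkp : k - ν < p) :
    (p - (k - ν) + 1) * (nuSets M k ν s).ncard ≤ (k + 1 - s) * (nuSets M (k + 1) ν s).ncard := by
  rw [← ncard_upsPairs_eq k ν s hν]
  refine S1.mul_le_ncard_of_fibres (upsPairs_finite k ν s) (nuSets_finite k ν s)
    (fun S => {R ∈ {R ∈ S1.incPairs M k (k - ν) | R.1 ∈ nuSets M k ν s ∧ R.2 ∈ S1.rkSets M (k + 1) (k - ν + 1)} | R.1 = S}) (fun S _ => fun _ h => h.1) ?_ (p - (k - ν) + 1) ?_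
  · intro S _ S' _ hSS
    rw [Function.onFun, Set.disjoint_left]
    rintro R ⟨-, h1⟩ ⟨-, h2⟩
    exact hSS (h1.symm.trans h2)
  · intro S hS
    rw [fibre_upsPairs_fst_eq hS]
    have hinj : InjOn (fun x => (S, insert x S)) {x ∈ M.E \ S | M.eRk (insert x S) = ((k - ν + 1 : ℕ) : ℕ∞)} := by
      intro x hx y _ hxy
      simp only [Prod.mk.injEq, true_and] at hxy
      exact (insert_inj hx.1.2).mp hxy
    rw [hinj.ncard_image]
    have h1 := ncard_ext_add_ncard_ext_succ (M := M) hS.1.2.2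
    have h2 := S1.ncard_extensions_add_le_of_coloops hM hcol hS.1.1 hS.1.2.2 hkp
    rw [ncard_sdiff' hS.1.1 M.ground_finite, hS.1.2.1] at h1
    rw [hS.1.2.1] at h2
    omega

end S4Ups

end PercRepro
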